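import Mathlib.Analysis.Convex.SimplicialComplex.Basic
import Mathlib.Data.Finset.Card
import Mathlib.Data.Fintype.Basic
import Mathlib.Logic.Relation
import Mathlib.Logic.Function.Basic
import Literature.Geometry.DiscreteGeometry.SphericalPolyhedralData
import HarnessLib

/-!
# Stellar moves: links, stars, antistars, stellar subdivision and weld, stellar equivalence,
# bistellar (Pachner) moves, combinatorial balls, spheres and manifolds

Topic `Literature/Topology/FourManifolds`; definition request `defn-StellarMoves` (D1 of route
`SmoothPoincare4/LogCYSkeleton`: the abstract-complex PL toolkit wanted next to `Collapsible.lean` /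
`SmoothTriangulation.lean` by `SkeletonCertificate`, `CertificateRecognition`, `BirationalCertificate`).

Everything here is the *combinatorial* theory of a family of faces `F : Set (Finset ι)` (the faces of
an abstract simplicial complex on the vertex type `ι`; down-closed and without the empty face, as in
Mathlib's `PreAbstractSimplicialComplex ι` / `Geometry.SimplicialComplex 𝕜 E`, to whose `faces` all
definitions apply verbatim), following Lickorish, *Simplicial moves on complexes and manifolds*
(1999) §§2–3, 5 and Datta, *Minimal triangulations of manifolds* (2007) §1:

* `Faces.vertexSet`, `Faces.antistar F v = {s ∈ F | v ∉ s}` (deletion of a vertex; literally the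
  clause of the route items), `Faces.deletion F A`, `Faces.closedStar F A`, `Faces.link F A`
  (`lk(A,K) = {B ∈ K : A ⋆ B ∈ K}` [Lickorish1999, §2]; `{β : β ∩ γ = ∅, βγ ∈ K}` [Datta2007, §1]),
  `Faces.simplex s` (the complex `Δ(s)` of all faces of a simplex), the boundary complex `∂Δ(s)` is
  REUSED from `Literature.Geometry.DiscreteGeometry.simplexBoundary`, `Faces.join`, `Faces.cone`,
  `Faces.downClosure` ("the closure": add all faces);
* `Faces.stellarSubdivision F A a` — starring `F` at the face `A` with a new vertex `a`: remove
  `st(A,K)` and insert `a ⋆ ∂A ⋆ lk(A,K)` [Lickorish1999, §3]; `Faces.IsStellarSubdivision F G`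
  (the move, `a` fresh; its converse is the stellar *weld*), `Faces.Isomorphic` (simplicial
  isomorphism = a relabelling injective on the vertices, possibly into another vertex type) and
  **`Faces.StellarEquivalent F G`**: `F` and `G` are related by a finite sequence of stellar
  subdivisions, welds and simplicial isomorphisms [Lickorish1999, §3];
* `Faces.bistellarMove F A B`, `Faces.IsBistellarMove`, `Faces.BistellarEquivalent`: the bistellar
  (Pachner) moves `κ(A,B)` [Lickorish1999, Def. 2.3, Def. 5.6], [Datta2007, §1];
* `Faces.IsCombinatorialBall n`, `Faces.IsCombinatorialSphere n` (stellar equivalent to `Δⁿ`, resp.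
  `∂Δⁿ⁺¹`), `Faces.IsCombinatorialManifold n` (every vertex link is a combinatorial `(n-1)`-ball or
  sphere) and `Faces.IsClosedCombinatorialManifold n` (every vertex link is an `(n-1)`-sphere)
  [Lickorish1999, Def. 3.1 with Thm. 4.5; Datta2007, §1 "Combinatorial Manifolds"].

Proved API: membership lemmas; the operations preserve down-closure; `closedStar ∪ antistar = F` and
`closedStar ∩ antistar = link` for a vertex; the closed star of a vertex is the cone on its link;
`Isomorphic` is reflexive/symmetric/transitive and `StellarEquivalent` is an equivalence relation on
one vertex type; the standard simplex/boundary on any `n + 1`/`n + 2` vertices is a combinatorial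
ball/sphere.  **No named facts are introduced** (the classical theorems — Alexander–Newman,
Lickorish Thm. 4.5 "PL homeomorphic ⟺ stellar equivalent", Pachner's Thm. 5.9 — live in the companion
facts file, so that importing this vocabulary adds nothing to a route's trust base).

## Design notes

* Lickorish's complexes contain the empty simplex and are finite; Mathlib's faces are nonempty, so
  `∅` is handled by side conditions (`s ∪ A` with `s = ∅` allowed in `stellarSubdivision`, `join`
  contains both factors).  Finiteness is *not* part of the definitions (it is a hypothesis of the
  facts); stellar moves preserve it (`stellarSubdivision_finite`).
* Fresh vertices.  A stellar subdivision needs a vertex `a ∉ vertexSet F`; Lickorish draws it from an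
  implicit infinite universe.  `StellarEquivalent F G` performs all moves inside the vertex type `ι`
  of its FIRST argument and ends with one isomorphism onto `G : Set (Finset κ)`; so the model
  complexes `Δⁿ`, `∂Δⁿ⁺¹` can be taken on `Fin (n+1)`, `Fin (n+2)`, and statements about finite
  complexes should assume `Infinite ι` (automatic for `ι = EuclideanSpace ℝ (Fin N)`).
* `n = 0`: `∂Δ⁰ = ∅ = Δ⁻¹`, so a `0`-manifold is a set of vertices, as it should be; the ball and
  sphere alternatives coincide there (harmless).
* Not here (see the facts file / later work): the realisation of a stellar subdivision of a
  *geometric* complex as a geometric subdivision; regular neighbourhoods; the boundary `∂M`.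

## References

* W. B. R. Lickorish, *Simplicial moves on complexes and manifolds*, Geom. Topol. Monogr. 2 (1999)
  299–320 = arXiv:math/9911256, §2 (Def. 2.1–2.3), §3 (starring, welds, stellar equivalence,
  Def. 3.1, Lemma 3.2, Thm. 3.8–3.9), §4 (Thm. 4.5), §5 (Def. 5.1, 5.6, Thm. 5.9). [Lickorish1999]
* B. Datta, *Minimal triangulations of manifolds*, J. Indian Inst. Sci. 87 (2007) 429–449 =
  arXiv:math/0701735, §1. [Datta2007]
* J. W. Alexander, *The combinatorial theory of complexes*, Ann. of Math. 31 (1930). [Alexander1930]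
* M. H. A. Newman, *On the foundations of combinatorial analysis situs* (1926). [Newman1926]
* U. Pachner, *P.L. homeomorphic manifolds are equivalent by elementary shellings*, European J.
  Combin. 12 (1991) 129–145. [Pachner1991]
-/

open Set Function

namespace Literature.Topology.FourManifolds

namespace Faces

open Literature.Geometry.DiscreteGeometry (simplexBoundary mem_simplexBoundary_faces)

variable {ι κ μ : Type*}

/-! ### Vertices, antistar, deletion, closed star, link, simplex, join, cone -/

/-- The **vertex set** of a family of faces: the union of its faces (for a down-closed family,
the `v` with `{v} ∈ F`, `mem_vertexSet_iff_singleton_mem`). [folklore] -/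
def vertexSet (F : Set (Finset ι)) : Set ι := ⋃ s ∈ F, (s : Set ι)

/-- **Antistar** (deletion) of a vertex: the faces not containing `v` — the closed complement of the
open star of `v`; literally the clause `{s ∈ K.faces | v ∉ s}` of route `SmoothPoincare4/LogCYSkeleton`.
[cite: Datta2007, §1 (stars, links; induced subcomplexes)] -/
def antistar (F : Set (Finset ι)) (v : ι) : Set (Finset ι) := {s ∈ F | v ∉ s}

/-- **Deletion** of a face `A`: the faces not containing `A` (for `A = {v}` this is `antistar F v`,
`deletion_singleton`). [folklore] -/
def deletion (F : Set (Finset ι)) (A : Finset ι) : Set (Finset ι) := {s ∈ F | ¬A ⊆ s}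

/-- The complex **`Δ(s)`** of a simplex: all nonempty subsets of the vertex set `s` ("the symbol `A`
used ambiguously for the simplex and the complex of all its faces" [cite: Lickorish1999, §2]).
Its boundary complex `∂Δ(s)` is `Literature.Geometry.DiscreteGeometry.simplexBoundary s`. -/
def simplex (s : Finset ι) : Set (Finset ι) := {t | t.Nonempty ∧ t ⊆ s}

/-- The **down-closure** of a set of simplices: all nonempty subsets of its members ("taking the
closure means adding on the smallest number of simplexes to achieve a simplicial complex"
[cite: Lickorish1999, §5 after Def. 5.2]).  `downClosure (S \ K)` is "the closure of `S - K`". -/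
def downClosure (S : Set (Finset ι)) : Set (Finset ι) := {t | t.Nonempty ∧ ∃ s ∈ S, t ⊆ s}

variable [DecidableEq ι]

/-- **Closed star** of a face `A`: the faces `s` of `F` with `s ∪ A ∈ F`, i.e. all faces of the
simplices containing `A`; `st(A,K) = A ⋆ lk(A,K)` [cite: Lickorish1999, §2 (link and closed star)]. -/
def closedStar (F : Set (Finset ι)) (A : Finset ι) : Set (Finset ι) := {s ∈ F | s ∪ A ∈ F}

/-- **Link** of a face `A`: the faces `s` of `F` disjoint from `A` with `s ∪ A ∈ F`;
`lk(A,K) = {B ∈ K : A ⋆ B ∈ K}` [cite: Lickorish1999, §2 (link and closed star)], `lk_K(γ) =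
{β : β ∩ γ = ∅, βγ ∈ K}` (Datta 2007, §1).  For a vertex of a `PreAbstractSimplicialComplex` this is
`Literature.Geometry.DiscreteGeometry.linkComplex` (`link_singleton_eq_linkComplex_faces`). -/
def link (F : Set (Finset ι)) (A : Finset ι) : Set (Finset ι) :=
  {s ∈ F | Disjoint s A ∧ s ∪ A ∈ F}

/-- **Join** of two families of faces on disjoint vertex sets:
`K ⋆ L = K ∪ L ∪ {αβ : α ∈ K, β ∈ L}` [cite: Datta2007, §1 (join of complexes)]. -/
def join (F G : Set (Finset ι)) : Set (Finset ι) := F ∪ G ∪ {u | ∃ s ∈ F, ∃ t ∈ G, u = s ∪ t}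

/-- The **cone** `a ⋆ F` with apex `a` (join with the one-vertex complex `{a}`). [folklore] -/
def cone (a : ι) (F : Set (Finset ι)) : Set (Finset ι) := join {({a} : Finset ι)} F

/-! ### Stellar subdivision, weld, stellar equivalence -/

/-- **Stellar subdivision** `(A, a)F`: star the family `F` at the face `A` with the (new) vertex
`a` — remove the simplices containing `A` (the open star) and insert the cone
`a ⋆ ∂A ⋆ lk(A,K)`, i.e. the faces `insert a s` for all `s` (possibly `∅`) with `A ⊄ s` and
`s ∪ A ∈ F` [cite: Lickorish1999, §3 (the operation (A,a) of starring K)]; Datta (2007), §1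
"starring the vertex `a` in `γ`".  The inverse operation is the stellar **weld** `(A,a)⁻¹`. -/
def stellarSubdivision (F : Set (Finset ι)) (A : Finset ι) (a : ι) : Set (Finset ι) :=
  deletion F A ∪ {t | ∃ s : Finset ι, ¬A ⊆ s ∧ s ∪ A ∈ F ∧ t = insert a s}

/-- `G` is obtained from `F` by **one stellar subdivision**: `G = (A,a)F` for a face `A ∈ F` and a
vertex `a` not in `F` ("in the abstract setting `a` is just a vertex not in `K`"); read backwards,
`F` is obtained from `G` by a stellar weld. [cite: Lickorish1999, §3 (stellar subdivision and weld)] -/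
def IsStellarSubdivision (F G : Set (Finset ι)) : Prop :=
  ∃ A ∈ F, ∃ a ∉ vertexSet F, G = stellarSubdivision F A a

omit [DecidableEq ι] in
/-- **Simplicial isomorphism** onto a family of faces on another vertex type: "a bijection between
their vertices that induces a bijection between their simplexes" [cite: Lickorish1999, §2 (simplicial isomorphism)] —
an equivalence `e` of vertex sets such that the faces of `G` are exactly the images of the faces of
`F`.  (`Isomorphic.of_bijOn` builds one from a map of the ambient vertex types.) -/
def Isomorphic (F : Set (Finset ι)) (G : Set (Finset κ)) : Prop :=
  ∃ e : vertexSet F ≃ vertexSet G, ∀ t : Finset κ,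
    t ∈ G ↔ ∃ s ∈ F, (t : Set κ) = Subtype.val '' (e '' {x : vertexSet F | (x : ι) ∈ s})

/-- **Stellar equivalence** `F ∼ G`: `F` and `G` are related by a finite sequence of stellar
subdivisions, stellar welds and simplicial isomorphisms [cite: Lickorish1999, §3 (stellar equivalent, K₁ ∼ K₂)];
"stellar equivalent if they have isomorphic stellar subdivisions" (Datta 2007, §1).  All moves are
performed on the vertex type `ι` of the first argument (the equivalence closure
`Relation.EqvGen` of "one subdivision or one isomorphism" supplies welds and composites) and the
chain ends with an isomorphism onto `G`, which may live on another vertex type. -/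
def StellarEquivalent (F : Set (Finset ι)) (G : Set (Finset κ)) : Prop :=
  ∃ F' : Set (Finset ι),
    Relation.EqvGen (fun X Y : Set (Finset ι) => IsStellarSubdivision X Y ∨ Isomorphic X Y) F F' ∧
      Isomorphic F' G

/-! ### Bistellar (Pachner) moves -/

/-- The result of the **bistellar move** `κ(A,B)`: remove `A ⋆ ∂B` (the simplices containing `A`)
and insert `∂A ⋆ B` (the faces `s ∪ B`, `s` a proper, possibly empty, face of `A`):
`L = (K ∖ {D : A ≤ D ∈ K}) ∪ {FB : F < A}` [cite: Datta2007, §1 (bistellar moves)];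
[Lickorish1999, Def. 2.3]. -/
def bistellarMove (F : Set (Finset ι)) (A B : Finset ι) : Set (Finset ι) :=
  deletion F A ∪ {t | ∃ s : Finset ι, s ⊂ A ∧ t = s ∪ B}

/-- `G` is obtained from `F` by **one bistellar move** `κ(A,B)`: `A ∈ F`, `B` is a nonempty simplex
not in `F` with `lk(A,F) = ∂B`, and `G = bistellarMove F A B` [cite: Lickorish1999, Def. 2.3];
(Datta 2007, §1).  For `B = {b}` the condition says `A` is a facet and `b` a new vertex (the move is
the stellar subdivision `(A,b)`); the inverse move is `κ(B,A)`. -/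
def IsBistellarMove (F G : Set (Finset ι)) : Prop :=
  ∃ A ∈ F, ∃ B : Finset ι, B.Nonempty ∧ B ∉ F ∧ link F A = (simplexBoundary B).faces ∧
    G = bistellarMove F A B

/-- **Bistellar equivalence**: related by a finite sequence of bistellar moves and simplicial
isomorphisms (conventions as for `StellarEquivalent`). [cite: Lickorish1999, Def. 5.6] -/
def BistellarEquivalent (F : Set (Finset ι)) (G : Set (Finset κ)) : Prop :=
  ∃ F' : Set (Finset ι),
    Relation.EqvGen (fun X Y : Set (Finset ι) => IsBistellarMove X Y ∨ Isomorphic X Y) F F' ∧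
      Isomorphic F' G

/-! ### Combinatorial balls, spheres and manifolds -/

/-- **Combinatorial `n`-ball**: a family of faces stellar equivalent to `Δⁿ` (modelled on the
`n + 1` vertices `Fin (n + 1)`).  Lickorish's "stellar `n`-ball" [cite: Lickorish1999, Def. 3.1], equal to
the combinatorial `n`-ball of Def. 2.2 (PL homeomorphic to `Δⁿ`) by Thm. 4.5 there. -/
def IsCombinatorialBall (n : ℕ) (F : Set (Finset ι)) : Prop :=
  StellarEquivalent F (simplex (Finset.univ : Finset (Fin (n + 1))))

/-- **Combinatorial `n`-sphere**: a family of faces stellar equivalent to `∂Δⁿ⁺¹` (modelled on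
`Fin (n + 2)`).  Lickorish's "stellar `n`-sphere" [cite: Lickorish1999, Def. 3.1], equal to the
combinatorial `n`-sphere of Def. 2.2 by Thm. 4.5; Datta (2007), §1 (`K ≈ S^d_{d+2}`). -/
def IsCombinatorialSphere (n : ℕ) (F : Set (Finset ι)) : Prop :=
  StellarEquivalent F (simplexBoundary (Finset.univ : Finset (Fin (n + 2)))).faces

/-- **Combinatorial `n`-manifold** (boundary allowed): the link of every vertex is a combinatorial
`(n-1)`-sphere `∂Δⁿ` or a combinatorial `(n-1)`-ball `Δⁿ⁻¹` (written with `n + 1`, resp. `n`, model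
vertices to avoid subtraction; see `isCombinatorialManifold_succ_iff`).  Lickorish's stellar
`n`-manifold [cite: Lickorish1999, Def. 3.1] (= combinatorial `n`-manifold, Def. 2.2, by Thm. 4.5); Datta (2007), §1
"combinatorial `d`-manifold with boundary" (who additionally asks for one ball link). -/
def IsCombinatorialManifold (n : ℕ) (F : Set (Finset ι)) : Prop :=
  ∀ v ∈ vertexSet F,
    StellarEquivalent (link F {v}) (simplexBoundary (Finset.univ : Finset (Fin (n + 1)))).faces ∨
      StellarEquivalent (link F {v}) (simplex (Finset.univ : Finset (Fin n)))

/-- **Closed combinatorial `n`-manifold**: the link of every vertex is a combinatorial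
`(n-1)`-sphere ("`lk_K(v) ≈ S^{d-1}_{d+1}` for each vertex `v`" [cite: Datta2007, §1 (Combinatorial Manifolds)];
Lickorish (1999): `∂M = ∅`). -/
def IsClosedCombinatorialManifold (n : ℕ) (F : Set (Finset ι)) : Prop :=
  ∀ v ∈ vertexSet F,
    StellarEquivalent (link F {v}) (simplexBoundary (Finset.univ : Finset (Fin (n + 1)))).faces

/-! ### API: membership and down-closure -/

omit [DecidableEq ι] in
/-- Membership in the vertex set. [folklore] -/
theorem mem_vertexSet {F : Set (Finset ι)} {v : ι} : v ∈ vertexSet F ↔ ∃ s ∈ F, v ∈ s := by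
  simp [vertexSet]

omit [DecidableEq ι] in
/-- In a down-closed family the vertices are the `v` with `{v} ∈ F`. [folklore] -/
theorem mem_vertexSet_iff_singleton_mem {F : Set (Finset ι)} (hF : IsRelLowerSet F Finset.Nonempty)
    {v : ι} : v ∈ vertexSet F ↔ ({v} : Finset ι) ∈ F := by
  refine ⟨fun h => ?_, fun h => mem_vertexSet.2 ⟨{v}, h, Finset.mem_singleton_self v⟩⟩
  obtain ⟨s, hs, hvs⟩ := mem_vertexSet.1 h
  exact (hF hs).2 (Finset.singleton_subset_iff.2 hvs) (Finset.singleton_nonempty v)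

omit [DecidableEq ι] in
/-- A vertex not in the vertex set lies in no face. [folklore] -/
theorem notMem_of_notMem_vertexSet {F : Set (Finset ι)} {a : ι} (ha : a ∉ vertexSet F) {s : Finset ι}
    (hs : s ∈ F) : a ∉ s := fun h => ha (mem_vertexSet.2 ⟨s, hs, h⟩)

omit [DecidableEq ι] in
/-- Membership in the antistar. [folklore] -/
@[simp] theorem mem_antistar {F : Set (Finset ι)} {v : ι} {s : Finset ι} :
    s ∈ antistar F v ↔ s ∈ F ∧ v ∉ s := Iff.rfl

omit [DecidableEq ι] in
/-- Membership in the deletion of a face. [folklore] -/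
@[simp] theorem mem_deletion {F : Set (Finset ι)} {A s : Finset ι} :
    s ∈ deletion F A ↔ s ∈ F ∧ ¬A ⊆ s := Iff.rfl

omit [DecidableEq ι] in
/-- Deleting a vertex is deleting the `0`-simplex on it. [folklore] -/
theorem deletion_singleton (F : Set (Finset ι)) (v : ι) : deletion F {v} = antistar F v := by
  ext s; simp [deletion, antistar]

omit [DecidableEq ι] in
/-- Membership in `Δ(s)`. [folklore] -/
@[simp] theorem mem_simplex {s t : Finset ι} : t ∈ simplex s ↔ t.Nonempty ∧ t ⊆ s := Iff.rfl

omit [DecidableEq ι] in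
/-- Membership in the down-closure. [folklore] -/
@[simp] theorem mem_downClosure {S : Set (Finset ι)} {t : Finset ι} :
    t ∈ downClosure S ↔ t.Nonempty ∧ ∃ s ∈ S, t ⊆ s := Iff.rfl

/-- Membership in the closed star. [folklore] -/
@[simp] theorem mem_closedStar {F : Set (Finset ι)} {A s : Finset ι} :
    s ∈ closedStar F A ↔ s ∈ F ∧ s ∪ A ∈ F := Iff.rfl

/-- Membership in the link. [folklore] -/
@[simp] theorem mem_link {F : Set (Finset ι)} {A s : Finset ι} :
    s ∈ link F A ↔ s ∈ F ∧ Disjoint s A ∧ s ∪ A ∈ F := Iff.rfl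

/-- Membership in a join. [folklore] -/
theorem mem_join {F G : Set (Finset ι)} {u : Finset ι} :
    u ∈ join F G ↔ u ∈ F ∨ u ∈ G ∨ ∃ s ∈ F, ∃ t ∈ G, u = s ∪ t := by
  simp [join, or_assoc]

/-- Membership in a cone: `{a}`, a face of the base, or `insert a` of a face of the base. [folklore] -/
theorem mem_cone {a : ι} {F : Set (Finset ι)} {u : Finset ι} :
    u ∈ cone a F ↔ u = {a} ∨ u ∈ F ∨ ∃ t ∈ F, u = insert a t := by
  simp [cone, mem_join]

/-- Membership in a stellar subdivision. [folklore] -/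
theorem mem_stellarSubdivision {F : Set (Finset ι)} {A : Finset ι} {a : ι} {t : Finset ι} :
    t ∈ stellarSubdivision F A a ↔
      (t ∈ F ∧ ¬A ⊆ t) ∨ ∃ s : Finset ι, ¬A ⊆ s ∧ s ∪ A ∈ F ∧ t = insert a s := by
  simp [stellarSubdivision, deletion]

/-- Membership in the result of a bistellar move. [folklore] -/
theorem mem_bistellarMove {F : Set (Finset ι)} {A B t : Finset ι} :
    t ∈ bistellarMove F A B ↔ (t ∈ F ∧ ¬A ⊆ t) ∨ ∃ s : Finset ι, s ⊂ A ∧ t = s ∪ B := by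
  simp [bistellarMove, deletion]

omit [DecidableEq ι] in
/-- The antistar is contained in the family. [folklore] -/
theorem antistar_subset (F : Set (Finset ι)) (v : ι) : antistar F v ⊆ F := fun _ h => h.1

/-- The link is contained in the closed star. [folklore] -/
theorem link_subset_closedStar (F : Set (Finset ι)) (A : Finset ι) : link F A ⊆ closedStar F A :=
  fun _ h => ⟨h.1, h.2.2⟩

/-- The closed star is contained in the family. [folklore] -/
theorem closedStar_subset (F : Set (Finset ι)) (A : Finset ι) : closedStar F A ⊆ F := fun _ h => h.1

omit [DecidableEq ι] in
/-- The antistar of a down-closed family is down-closed (a subcomplex). [folklore] -/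
theorem isRelLowerSet_antistar {F : Set (Finset ι)} (hF : IsRelLowerSet F Finset.Nonempty) (v : ι) :
    IsRelLowerSet (antistar F v) Finset.Nonempty := fun _ hs =>
  ⟨(hF hs.1).1, fun _ hts ht => ⟨(hF hs.1).2 hts ht, fun hv => hs.2 (hts hv)⟩⟩

omit [DecidableEq ι] in
/-- The deletion of a face of a down-closed family is down-closed. [folklore] -/
theorem isRelLowerSet_deletion {F : Set (Finset ι)} (hF : IsRelLowerSet F Finset.Nonempty)
    (A : Finset ι) : IsRelLowerSet (deletion F A) Finset.Nonempty := fun _ hs =>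
  ⟨(hF hs.1).1, fun _ hts ht => ⟨(hF hs.1).2 hts ht, fun hA => hs.2 (hA.trans hts)⟩⟩

/-- The closed star in a down-closed family is down-closed. [folklore] -/
theorem isRelLowerSet_closedStar {F : Set (Finset ι)} (hF : IsRelLowerSet F Finset.Nonempty)
    (A : Finset ι) : IsRelLowerSet (closedStar F A) Finset.Nonempty := fun _ hs =>
  ⟨(hF hs.1).1, fun _ hts ht => ⟨(hF hs.1).2 hts ht,
    (hF hs.2).2 (Finset.union_subset_union hts Finset.Subset.rfl) (ht.mono Finset.subset_union_left)⟩⟩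

/-- The link in a down-closed family is down-closed. [folklore] -/
theorem isRelLowerSet_link {F : Set (Finset ι)} (hF : IsRelLowerSet F Finset.Nonempty) (A : Finset ι) :
    IsRelLowerSet (link F A) Finset.Nonempty := fun _ hs =>
  ⟨(hF hs.1).1, fun _ hts ht => ⟨(hF hs.1).2 hts ht, hs.2.1.mono_left hts,
    (hF hs.2.2).2 (Finset.union_subset_union hts Finset.Subset.rfl) (ht.mono Finset.subset_union_left)⟩⟩

omit [DecidableEq ι] in
/-- `Δ(s)` is down-closed. [folklore] -/
theorem isRelLowerSet_simplex (s : Finset ι) : IsRelLowerSet (simplex s) Finset.Nonempty :=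
  fun _ ht => ⟨ht.1, fun _ hut hu => ⟨hu, hut.trans ht.2⟩⟩

omit [DecidableEq ι] in
/-- The down-closure is down-closed. [folklore] -/
theorem isRelLowerSet_downClosure (S : Set (Finset ι)) :
    IsRelLowerSet (downClosure S) Finset.Nonempty := fun _ ht =>
  ⟨ht.1, fun _ hut hu => ⟨hu, ht.2.imp fun _ h => ⟨h.1, hut.trans h.2⟩⟩⟩

omit [DecidableEq ι] in
/-- A down-closed family is its own down-closure. [folklore] -/
theorem downClosure_eq_self {F : Set (Finset ι)} (hF : IsRelLowerSet F Finset.Nonempty) :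
    downClosure F = F := by
  refine Set.Subset.antisymm (fun t ⟨ht, s, hs, hts⟩ => (hF hs).2 hts ht) fun t ht => ?_
  exact ⟨(hF ht).1, t, ht, Finset.Subset.rfl⟩

/-- The vertex link of a `PreAbstractSimplicialComplex` is the link complex of
`Literature.Geometry.DiscreteGeometry` (bridge; no notion is duplicated). [folklore] -/
theorem link_singleton_eq_linkComplex_faces (K : PreAbstractSimplicialComplex ι) (v : ι) :
    link K.faces {v} = (Literature.Geometry.DiscreteGeometry.linkComplex K v).faces := by
  ext s
  simp only [mem_link, Finset.disjoint_singleton_right,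
    Literature.Geometry.DiscreteGeometry.mem_linkComplex_faces]
  constructor
  · rintro ⟨hs, hv, hsv⟩
    exact ⟨hv, by rwa [Finset.insert_eq, Finset.union_comm], (K.isRelLowerSet_faces hs).1⟩
  · rintro ⟨hv, hsv, hne⟩
    rw [Finset.insert_eq, Finset.union_comm] at hsv
    exact ⟨(K.isRelLowerSet_faces hsv).2 Finset.subset_union_left hne, hv, hsv⟩

/-! ### API: the vertex case — star, antistar and link -/

/-- `K = st(v) ∪ ast(v)`: every face lies in the closed star of a vertex or avoids it.
[folklore] -/
theorem closedStar_union_antistar (F : Set (Finset ι)) (v : ι) :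
    closedStar F {v} ∪ antistar F v = F := by
  refine Set.Subset.antisymm (Set.union_subset (closedStar_subset F _) (antistar_subset F v)) ?_
  intro s hs
  by_cases hv : v ∈ s
  · exact Or.inl ⟨hs, by rwa [Finset.union_eq_left.2 (Finset.singleton_subset_iff.2 hv)]⟩
  · exact Or.inr ⟨hs, hv⟩

/-- `st(v) ∩ ast(v) = lk(v)`. [folklore] -/
theorem closedStar_inter_antistar (F : Set (Finset ι)) (v : ι) :
    closedStar F {v} ∩ antistar F v = link F {v} := by
  ext s
  simp only [Set.mem_inter_iff, mem_closedStar, mem_antistar, mem_link,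
    Finset.disjoint_singleton_right]
  tauto

/-- **The closed star of a vertex is the cone on its link**, `st(v,K) = v ⋆ lk(v,K)`, for a
down-closed family containing the vertex. [cite: Lickorish1999, §2 (st(A,K) = A ⋆ lk(A,K))] -/
theorem closedStar_singleton_eq_cone_link {F : Set (Finset ι)} (hF : IsRelLowerSet F Finset.Nonempty)
    {v : ι} (hv : ({v} : Finset ι) ∈ F) : closedStar F {v} = cone v (link F {v}) := by
  ext u
  simp only [mem_closedStar, mem_cone, mem_link, Finset.disjoint_singleton_right]
  constructor
  · rintro ⟨hu, huv⟩
    by_cases hvu : v ∈ u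
    · by_cases h1 : u = {v}
      · exact Or.inl h1
      · have hnt : u.Nontrivial := (Finset.eq_singleton_or_nontrivial hvu).resolve_left h1
        obtain ⟨w, hw, hwv⟩ := hnt.exists_ne v
        have hne : (u.erase v).Nonempty := ⟨w, Finset.mem_erase.2 ⟨hwv, hw⟩⟩
        have hut : insert v (u.erase v) = u := Finset.insert_erase hvu
        refine Or.inr (Or.inr ⟨u.erase v, ⟨(hF hu).2 (Finset.erase_subset v u) hne,
          Finset.notMem_erase v u, ?_⟩, hut.symm⟩)
        rwa [Finset.union_comm, ← Finset.insert_eq, hut]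
    · exact Or.inr (Or.inl ⟨hu, hvu, huv⟩)
  · rintro (rfl | ⟨hu, -, huv⟩ | ⟨t, ⟨-, -, htv⟩, rfl⟩)
    · refine ⟨hv, ?_⟩
      rwa [Finset.union_idempotent]
    · exact ⟨hu, huv⟩
    · rw [Finset.union_comm, ← Finset.insert_eq] at htv
      refine ⟨htv, ?_⟩
      rwa [Finset.union_comm, ← Finset.insert_eq, Finset.insert_idem]

/-! ### API: stellar subdivision -/

/-- The new vertex spans a face of the subdivision iff the starred face belongs to the family
(the case `s = ∅` of the inserted cone). [folklore] -/
theorem singleton_mem_stellarSubdivision {F : Set (Finset ι)} (hF : IsRelLowerSet F Finset.Nonempty)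
    {A : Finset ι} {a : ι} (ha : a ∉ vertexSet F) :
    ({a} : Finset ι) ∈ stellarSubdivision F A a ↔ A ∈ F := by
  rw [mem_stellarSubdivision]
  constructor
  · rintro (⟨haF, -⟩ | ⟨s, -, hsA, has⟩)
    · exact (notMem_of_notMem_vertexSet ha haF (Finset.mem_singleton_self a)).elim
    · have hs : s = ∅ := by
        by_contra hne
        obtain ⟨x, hx⟩ := Finset.nonempty_iff_ne_empty.2 hne
        have hxa : x ∈ ({a} : Finset ι) := by rw [has]; exact Finset.mem_insert_of_mem hx
        rw [Finset.mem_singleton] at hxa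
        exact notMem_of_notMem_vertexSet ha hsA (Finset.mem_union_left A (hxa ▸ hx))
      subst hs
      simpa using hsA
  · intro hA
    refine Or.inr ⟨∅, fun h => Finset.not_nonempty_empty ((hF hA).1.mono h), by simpa using hA, by simp⟩

/-- The faces of `F` not containing `A` survive the subdivision. [folklore] -/
theorem deletion_subset_stellarSubdivision (F : Set (Finset ι)) (A : Finset ι) (a : ι) :
    deletion F A ⊆ stellarSubdivision F A a := Set.subset_union_left

/-- **A stellar subdivision of a complex is a complex**: starring a down-closed family of nonempty
faces at one of its faces gives a down-closed family of nonempty faces.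
[cite: Lickorish1999, §3 (the operation (A,a) of starring K)] -/
theorem isRelLowerSet_stellarSubdivision {F : Set (Finset ι)} (hF : IsRelLowerSet F Finset.Nonempty)
    {A : Finset ι} (hA : A ∈ F) (a : ι) :
    IsRelLowerSet (stellarSubdivision F A a) Finset.Nonempty := by
  intro t ht
  rcases mem_stellarSubdivision.1 ht with ⟨htF, hAt⟩ | ⟨s, hAs, hsA, rfl⟩
  · exact ⟨(hF htF).1, fun u hut hu => Or.inl ⟨(hF htF).2 hut hu, fun hA' => hAt (hA'.trans hut)⟩⟩
  · refine ⟨Finset.insert_nonempty a s, fun u hut hu => ?_⟩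
    by_cases hau : a ∈ u
    · have hus : u.erase a ⊆ s := fun x hx => by
        have hx' := Finset.mem_erase.1 hx
        exact (Finset.mem_insert.1 (hut hx'.2)).resolve_left hx'.1
      refine Or.inr ⟨u.erase a, fun h => hAs (h.trans hus), ?_, (Finset.insert_erase hau).symm⟩
      exact (hF hsA).2 (Finset.union_subset_union hus Finset.Subset.rfl)
        ((hF hA).1.mono Finset.subset_union_right)
    · have hus : u ⊆ s := fun x hx =>
        (Finset.mem_insert.1 (hut hx)).resolve_left fun h => hau (h ▸ hx)
      exact Or.inl ⟨(hF hsA).2 (hus.trans Finset.subset_union_left) hu, fun hA' => hAs (hA'.trans hus)⟩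

/-- A stellar subdivision of a finite family is finite. [folklore] -/
theorem stellarSubdivision_finite {F : Set (Finset ι)} (hF : F.Finite) (A : Finset ι) (a : ι) :
    (stellarSubdivision F A a).Finite := by
  refine (hF.subset fun _ h => h.1).union ?_
  refine ((hF.biUnion fun t _ => (t.powerset : Set (Finset ι)).toFinite).image (insert a)).subset ?_
  rintro _ ⟨s, -, hsA, rfl⟩
  exact ⟨s, Set.mem_biUnion hsA (by simp), rfl⟩

/-! ### API: isomorphism and stellar equivalence -/

omit [DecidableEq ι] in
/-- A face lies in the vertex set. [folklore] -/
theorem subset_vertexSet {F : Set (Finset ι)} {s : Finset ι} (hs : s ∈ F) : (s : Set ι) ⊆ vertexSet F :=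
  fun _ hx => mem_vertexSet.2 ⟨s, hs, hx⟩

omit [DecidableEq ι] in
/-- Auxiliary: the subtype copy of a face inside a vertex set projects back onto the face. [folklore] -/
theorem val_image_setOf_mem {V : Set ι} {s : Finset ι} (hs : (s : Set ι) ⊆ V) :
    Subtype.val '' {x : V | (x : ι) ∈ s} = s := by
  ext y
  exact ⟨fun ⟨x, hx, hxy⟩ => hxy ▸ hx, fun hy => ⟨⟨y, hs hy⟩, hy, rfl⟩⟩

omit [DecidableEq ι] in
/-- Auxiliary: the subtype copy of an image face is the image of the subtype copy. [folklore] -/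
theorem setOf_mem_eq_image {V : Set ι} {W : Set κ} (e : V ≃ W) {s : Finset ι} {t : Finset κ}
    (h : (t : Set κ) = Subtype.val '' (e '' {x : V | (x : ι) ∈ s})) :
    {y : W | (y : κ) ∈ t} = e '' {x : V | (x : ι) ∈ s} := by
  ext y
  change (y : κ) ∈ (t : Set κ) ↔ _
  rw [h]
  exact ⟨fun ⟨z, hz, hzy⟩ => Subtype.val_injective hzy ▸ hz, fun hy => ⟨y, hy, rfl⟩⟩

omit [DecidableEq ι] in
/-- Auxiliary: the subtype copy of a face is finite. [folklore] -/
theorem finite_setOf_mem (V : Set ι) (s : Finset ι) : {x : V | (x : ι) ∈ s}.Finite :=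
  s.finite_toSet.preimage Subtype.val_injective.injOn

omit [DecidableEq ι] in
/-- **Isomorphisms from vertex maps**: a map of vertex types which is a bijection between the
vertex sets and carries the faces of `F` exactly onto those of `G` is a simplicial isomorphism.
[folklore] -/
theorem Isomorphic.of_bijOn {F : Set (Finset ι)} {G : Set (Finset κ)} (f : ι → κ)
    (hf : Set.BijOn f (vertexSet F) (vertexSet G))
    (hG : ∀ t : Finset κ, t ∈ G ↔ ∃ s ∈ F, (t : Set κ) = f '' (s : Set ι)) : Isomorphic F G := by
  refine ⟨hf.equiv f, fun t => (hG t).trans (exists_congr fun s => and_congr_right fun hs => ?_)⟩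
  have : Subtype.val '' ((hf.equiv f) '' {x : vertexSet F | (x : ι) ∈ s}) = f '' (s : Set ι) := by
    rw [Set.image_image]
    ext y
    exact ⟨fun ⟨x, hx, hxy⟩ => ⟨x, hx, hxy⟩, fun ⟨x, hx, hxy⟩ => ⟨⟨x, subset_vertexSet hs hx⟩, hx, hxy⟩⟩
  rw [this]

omit [DecidableEq ι] in
/-- The identity is a simplicial isomorphism. [folklore] -/
theorem Isomorphic.refl (F : Set (Finset ι)) : Isomorphic F F :=
  Isomorphic.of_bijOn id (Set.bijOn_id _) fun t =>
    ⟨fun ht => ⟨t, ht, by simp⟩, fun ⟨s, hs, hts⟩ => by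
      rw [Set.image_id, Finset.coe_inj] at hts
      exact hts ▸ hs⟩

omit [DecidableEq ι] in
/-- Simplicial isomorphism is symmetric. [folklore] -/
theorem Isomorphic.symm {F : Set (Finset ι)} {G : Set (Finset κ)} (h : Isomorphic F G) :
    Isomorphic G F := by
  obtain ⟨e, he⟩ := h
  refine ⟨e.symm, fun s => ⟨fun hs => ?_, ?_⟩⟩
  · have hfin : (Subtype.val '' (e '' {x : vertexSet F | (x : ι) ∈ s})).Finite :=
      ((finite_setOf_mem _ s).image e).image _
    refine ⟨hfin.toFinset, (he _).2 ⟨s, hs, by rw [Set.Finite.coe_toFinset]⟩, ?_⟩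
    rw [setOf_mem_eq_image e (t := hfin.toFinset) (by rw [Set.Finite.coe_toFinset]),
      Equiv.symm_image_image, val_image_setOf_mem (subset_vertexSet hs)]
  · rintro ⟨t, ht, hst⟩
    obtain ⟨s', hs', hts'⟩ := (he t).1 ht
    rw [setOf_mem_eq_image e hts', Equiv.symm_image_image, val_image_setOf_mem (subset_vertexSet hs'),
      Finset.coe_inj] at hst
    exact hst ▸ hs'

omit [DecidableEq ι] in
/-- Simplicial isomorphism is transitive. [folklore] -/
theorem Isomorphic.trans {F : Set (Finset ι)} {G : Set (Finset κ)} {H : Set (Finset μ)}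
    (h₁ : Isomorphic F G) (h₂ : Isomorphic G H) : Isomorphic F H := by
  obtain ⟨e, he⟩ := h₁
  obtain ⟨e', he'⟩ := h₂
  refine ⟨e.trans e', fun t => ⟨fun ht => ?_, ?_⟩⟩
  · obtain ⟨g, hg, htg⟩ := (he' t).1 ht
    obtain ⟨s, hs, hgs⟩ := (he g).1 hg
    refine ⟨s, hs, ?_⟩
    rw [htg, setOf_mem_eq_image e hgs, Equiv.coe_trans, Set.image_comp]
  · rintro ⟨s, hs, hts⟩
    have hfin : (Subtype.val '' (e '' {x : vertexSet F | (x : ι) ∈ s})).Finite :=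
      ((finite_setOf_mem _ s).image e).image _
    have hg : hfin.toFinset ∈ G := (he _).2 ⟨s, hs, by rw [Set.Finite.coe_toFinset]⟩
    refine (he' t).2 ⟨hfin.toFinset, hg, ?_⟩
    rw [setOf_mem_eq_image e (t := hfin.toFinset) (by rw [Set.Finite.coe_toFinset]), hts,
      Equiv.coe_trans, Set.image_comp]

/-- A single stellar subdivision is a stellar equivalence. [folklore] -/
theorem StellarEquivalent.of_isStellarSubdivision {F G : Set (Finset ι)} (h : IsStellarSubdivision F G) :
    StellarEquivalent F G :=
  ⟨G, Relation.EqvGen.rel _ _ (Or.inl h), Isomorphic.refl G⟩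

/-- A stellar weld (an inverse subdivision) is a stellar equivalence. [folklore] -/
theorem StellarEquivalent.of_isStellarSubdivision_symm {F G : Set (Finset ι)}
    (h : IsStellarSubdivision G F) : StellarEquivalent F G :=
  ⟨G, Relation.EqvGen.symm _ _ (Relation.EqvGen.rel _ _ (Or.inl h)), Isomorphic.refl G⟩

/-- Isomorphic families are stellar equivalent. [folklore] -/
theorem StellarEquivalent.of_isomorphic {F : Set (Finset ι)} {G : Set (Finset κ)} (h : Isomorphic F G) :
    StellarEquivalent F G :=
  ⟨F, Relation.EqvGen.refl _, h⟩

/-- Stellar equivalence is reflexive. [folklore] -/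
theorem StellarEquivalent.refl (F : Set (Finset ι)) : StellarEquivalent F F :=
  StellarEquivalent.of_isomorphic (Isomorphic.refl F)

/-- Post-composition with an isomorphism (e.g. onto another vertex type). [folklore] -/
theorem StellarEquivalent.trans_isomorphic {F : Set (Finset ι)} {G : Set (Finset κ)}
    {H : Set (Finset μ)} (h₁ : StellarEquivalent F G) (h₂ : Isomorphic G H) : StellarEquivalent F H := by
  obtain ⟨F', hFF', hF'G⟩ := h₁
  exact ⟨F', hFF', hF'G.trans h₂⟩

/-- Stellar equivalence on one vertex type is symmetric. [folklore] -/
theorem StellarEquivalent.symm {F G : Set (Finset ι)} (h : StellarEquivalent F G) :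
    StellarEquivalent G F := by
  obtain ⟨F', hFF', hF'G⟩ := h
  exact ⟨F, Relation.EqvGen.trans _ _ _ (Relation.EqvGen.rel _ _ (Or.inr hF'G.symm))
    (Relation.EqvGen.symm _ _ hFF'), Isomorphic.refl F⟩

/-- Stellar equivalence is transitive in its first (same-vertex-type) leg; with `refl`/`symm` it is an
equivalence relation on the families of faces of one vertex type. [folklore] -/
theorem StellarEquivalent.trans {F G : Set (Finset ι)} {H : Set (Finset κ)} (h₁ : StellarEquivalent F G)
    (h₂ : StellarEquivalent G H) : StellarEquivalent F H := by
  obtain ⟨F', hFF', hF'G⟩ := h₁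
  obtain ⟨G', hGG', hG'H⟩ := h₂
  exact ⟨G', Relation.EqvGen.trans _ _ _
    (Relation.EqvGen.trans _ _ _ hFF' (Relation.EqvGen.rel _ _ (Or.inr hF'G))) hGG', hG'H⟩

/-! ### API: the model ball and sphere -/

omit [DecidableEq ι] in
/-- The vertices of `Δ(s)` are the elements of `s`. [folklore] -/
theorem vertexSet_simplex (s : Finset ι) : vertexSet (simplex s) = s := by
  refine Set.Subset.antisymm (fun x hx => ?_) fun x hx =>
    mem_vertexSet.2 ⟨s, ⟨⟨x, hx⟩, Finset.Subset.rfl⟩, hx⟩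
  obtain ⟨t, ht, hxt⟩ := mem_vertexSet.1 hx
  exact ht.2 hxt

omit [DecidableEq ι] in
/-- The vertices of `∂Δ(s)` are the elements of `s`, as soon as `s` has two elements. [folklore] -/
theorem vertexSet_simplexBoundary {s : Finset ι} (h2 : 2 ≤ s.card) :
    vertexSet (simplexBoundary s).faces = s := by
  refine Set.Subset.antisymm (fun x hx => ?_) fun x hx => ?_
  · obtain ⟨t, ht, hxt⟩ := mem_vertexSet.1 hx
    exact (mem_simplexBoundary_faces.1 ht).2.subset hxt
  · refine mem_vertexSet.2 ⟨{x}, mem_simplexBoundary_faces.2 ⟨Finset.singleton_nonempty x,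
      Finset.ssubset_iff_subset_ne.2 ⟨Finset.singleton_subset_iff.2 hx, fun h => ?_⟩⟩,
      Finset.mem_singleton_self x⟩
    rw [← h, Finset.card_singleton] at h2
    omega

omit [DecidableEq ι] in
/-- Auxiliary: a bijective relabelling of an `(n+1)`-element vertex set by `Fin (n + 1)`, together
with preimages of faces. [folklore] -/
theorem exists_bijOn_fin {s : Finset ι} {n : ℕ} (hs : s.card = n + 1) :
    ∃ f : ι → Fin (n + 1), Set.BijOn f s Set.univ ∧
      ∀ t : Finset (Fin (n + 1)), ∃ u ⊆ s, (t : Set (Fin (n + 1))) = f '' (u : Set ι) := by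
  classical
  let e : s ≃ Fin (n + 1) := s.equivFinOfCardEq hs
  let f : ι → Fin (n + 1) := fun x => if hx : x ∈ s then e ⟨x, hx⟩ else 0
  have hf : ∀ x (hx : x ∈ s), f x = e ⟨x, hx⟩ := fun x hx => dif_pos hx
  have hbij : Set.BijOn f s Set.univ := by
    refine ⟨fun _ _ => Set.mem_univ _, fun x hx y hy hxy => ?_, fun i _ => ⟨e.symm i, (e.symm i).2, ?_⟩⟩
    · rw [Finset.mem_coe] at hx hy
      rw [hf x hx, hf y hy] at hxy
      exact congrArg Subtype.val (e.injective hxy)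
    · rw [hf _ (e.symm i).2, Subtype.coe_eta, Equiv.apply_symm_apply]
  refine ⟨f, hbij, fun t => ⟨s.filter (fun x => f x ∈ t), Finset.filter_subset _ _, ?_⟩⟩
  ext i
  simp only [Finset.coe_filter, Set.mem_image, Set.mem_setOf_eq, Finset.mem_coe]
  constructor
  · intro hi
    obtain ⟨x, hx, rfl⟩ := hbij.surjOn (Set.mem_univ i)
    exact ⟨x, ⟨hx, hi⟩, rfl⟩
  · rintro ⟨x, ⟨-, hx⟩, rfl⟩
    exact hx

omit [DecidableEq ι] in
/-- `Δ(s)` on any `n + 1` vertices is isomorphic to the model `Δⁿ` on `Fin (n + 1)`. [folklore] -/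
theorem isomorphic_simplex_univ {s : Finset ι} {n : ℕ} (hs : s.card = n + 1) :
    Isomorphic (simplex s) (simplex (Finset.univ : Finset (Fin (n + 1)))) := by
  obtain ⟨f, hf, himg⟩ := exists_bijOn_fin hs
  refine Isomorphic.of_bijOn f (by rwa [vertexSet_simplex, vertexSet_simplex, Finset.coe_univ]) fun t => ?_
  simp only [mem_simplex, Finset.subset_univ, and_true]
  constructor
  · intro ht
    obtain ⟨u, hus, htu⟩ := himg t
    refine ⟨u, ⟨?_, hus⟩, htu⟩
    obtain ⟨i, hi⟩ := ht
    have hi' : (i : Fin (n + 1)) ∈ (t : Set (Fin (n + 1))) := hi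
    rw [htu] at hi'
    obtain ⟨x, hx, -⟩ := hi'
    exact ⟨x, hx⟩
  · rintro ⟨u, ⟨⟨x, hx⟩, -⟩, htu⟩
    exact ⟨f x, by rw [← Finset.mem_coe, htu]; exact ⟨x, hx, rfl⟩⟩

omit [DecidableEq ι] in
/-- `∂Δ(s)` on any `n + 2` vertices is isomorphic to the model `∂Δⁿ⁺¹` on `Fin (n + 2)`. [folklore] -/
theorem isomorphic_simplexBoundary_univ {s : Finset ι} {n : ℕ} (hs : s.card = n + 2) :
    Isomorphic (simplexBoundary s).faces (simplexBoundary (Finset.univ : Finset (Fin (n + 2)))).faces := by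
  obtain ⟨f, hf, himg⟩ := exists_bijOn_fin hs
  have h2 : 2 ≤ s.card := by omega
  have h2' : 2 ≤ (Finset.univ : Finset (Fin (n + 2))).card := by
    rw [Finset.card_univ, Fintype.card_fin]; omega
  refine Isomorphic.of_bijOn f
    (by rw [vertexSet_simplexBoundary h2, vertexSet_simplexBoundary h2', Finset.coe_univ]; exact hf) fun t => ?_
  -- a subset of `s` is all of `s` iff its image is everything
  have key : ∀ u : Finset ι, u ⊆ s → (Set.univ = f '' (u : Set ι) ↔ u = s) := fun u hu => by
    constructor
    · intro h
      refine Finset.Subset.antisymm hu fun x hx => ?_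
      obtain ⟨y, hy, hxy⟩ : f x ∈ f '' (u : Set ι) := h ▸ Set.mem_univ _
      rwa [← hf.injOn (Finset.mem_coe.2 (hu hy)) (Finset.mem_coe.2 hx) hxy]
    · rintro rfl
      exact hf.image_eq.symm
  simp only [mem_simplexBoundary_faces]
  constructor
  · rintro ⟨ht, hts⟩
    obtain ⟨u, hus, htu⟩ := himg t
    refine ⟨u, ⟨?_, Finset.ssubset_iff_subset_ne.2 ⟨hus, fun h => hts.ne ?_⟩⟩, htu⟩
    · obtain ⟨i, hi⟩ := ht
      have hi' : (i : Fin (n + 2)) ∈ (t : Set (Fin (n + 2))) := hi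
      rw [htu] at hi'
      obtain ⟨x, hx, -⟩ := hi'
      exact ⟨x, hx⟩
    · rw [← Finset.coe_inj, htu, h, hf.image_eq, Finset.coe_univ]
  · rintro ⟨u, ⟨hune, hus⟩, htu⟩
    refine ⟨?_, Finset.ssubset_iff_subset_ne.2 ⟨Finset.subset_univ _, fun h => hus.ne ((key u hus.subset).1 ?_)⟩⟩
    · obtain ⟨x, hx⟩ := hune
      exact ⟨f x, by rw [← Finset.mem_coe, htu]; exact ⟨x, hx, rfl⟩⟩
    · rw [← htu, h, Finset.coe_univ]

/-- **`Δ(s)` is a combinatorial `n`-ball** for `|s| = n + 1`. [folklore] -/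
theorem isCombinatorialBall_simplex {s : Finset ι} {n : ℕ} (hs : s.card = n + 1) :
    IsCombinatorialBall n (simplex s) :=
  StellarEquivalent.of_isomorphic (isomorphic_simplex_univ hs)

/-- **`∂Δ(s)` is a combinatorial `n`-sphere** for `|s| = n + 2`. [folklore] -/
theorem isCombinatorialSphere_simplexBoundary {s : Finset ι} {n : ℕ} (hs : s.card = n + 2) :
    IsCombinatorialSphere n (simplexBoundary s).faces :=
  StellarEquivalent.of_isomorphic (isomorphic_simplexBoundary_univ hs)

/-- Unfolding of `IsCombinatorialManifold (n + 1)`: every vertex link is a combinatorial `n`-sphere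
or a combinatorial `n`-ball. [folklore] -/
theorem isCombinatorialManifold_succ_iff {n : ℕ} {F : Set (Finset ι)} :
    IsCombinatorialManifold (n + 1) F ↔
      ∀ v ∈ vertexSet F, IsCombinatorialSphere n (link F {v}) ∨ IsCombinatorialBall n (link F {v}) :=
  Iff.rfl

/-- A closed combinatorial manifold is a combinatorial manifold. [folklore] -/
theorem IsClosedCombinatorialManifold.isCombinatorialManifold {n : ℕ} {F : Set (Finset ι)}
    (h : IsClosedCombinatorialManifold n F) : IsCombinatorialManifold n F :=
  fun v hv => Or.inl (h v hv)

/-! ### API: `∂Δⁿ⁺¹` is a closed combinatorial `n`-manifold -/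

omit [DecidableEq ι] in
/-- The boundary complex of a `0`-simplex is empty. [folklore] -/
theorem simplexBoundary_faces_eq_empty {s : Finset ι} (hs : s.card = 1) :
    (simplexBoundary s).faces = ∅ := by
  ext t
  simp only [mem_simplexBoundary_faces, Set.mem_empty_iff_false, iff_false, not_and]
  intro htne hts
  obtain ⟨x, rfl⟩ := Finset.card_eq_one.1 hs
  rcases Finset.subset_singleton_iff.1 hts.subset with h | h
  · exact htne.ne_empty h
  · exact hts.ne h

omit [DecidableEq ι] in
/-- The empty family has no vertices. [folklore] -/
theorem vertexSet_empty : vertexSet (∅ : Set (Finset ι)) = ∅ := by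
  simp [vertexSet]

omit [DecidableEq ι] in
/-- Empty families (on any vertex types) are isomorphic. [folklore] -/
theorem isomorphic_empty : Isomorphic (∅ : Set (Finset ι)) (∅ : Set (Finset κ)) := by
  haveI : IsEmpty (vertexSet (∅ : Set (Finset ι))) := by rw [vertexSet_empty]; infer_instance
  haveI : IsEmpty (vertexSet (∅ : Set (Finset κ))) := by rw [vertexSet_empty]; infer_instance
  exact ⟨Equiv.equivOfIsEmpty _ _, fun t => by simp⟩

omit [DecidableEq ι] in
/-- `∂Δ(s)` on `m + 1` vertices is isomorphic to the model boundary complex on `Fin (m + 1)`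
(including the empty case `m = 0`). [folklore] -/
theorem isomorphic_simplexBoundary_univ' {s : Finset ι} {m : ℕ} (hs : s.card = m + 1) :
    Isomorphic (simplexBoundary s).faces (simplexBoundary (Finset.univ : Finset (Fin (m + 1)))).faces := by
  cases m with
  | zero =>
    rw [simplexBoundary_faces_eq_empty hs, simplexBoundary_faces_eq_empty (by simp)]
    exact isomorphic_empty
  | succ n => exact isomorphic_simplexBoundary_univ hs

/-- **The link of a vertex of `∂Δ(s)` is `∂Δ(s ∖ {v})`.** [folklore] -/
theorem link_simplexBoundary_singleton {s : Finset ι} {v : ι} (hv : v ∈ s) :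
    link (simplexBoundary s).faces {v} = (simplexBoundary (s.erase v)).faces := by
  ext t
  simp only [mem_link, mem_simplexBoundary_faces, Finset.disjoint_singleton_right]
  constructor
  · rintro ⟨⟨htne, hts⟩, hvt, -, htvs⟩
    refine ⟨htne, Finset.ssubset_iff_subset_ne.2
      ⟨fun x hx => Finset.mem_erase.2 ⟨fun h => hvt (h ▸ hx), hts.1 hx⟩, ?_⟩⟩
    rintro rfl
    apply htvs.ne
    rw [Finset.union_comm, ← Finset.insert_eq, Finset.insert_erase hv]
  · rintro ⟨htne, hts⟩
    have hts' : t ⊆ s := fun x hx => (Finset.mem_erase.1 (hts.1 hx)).2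
    have hvt : v ∉ t := fun h => (Finset.mem_erase.1 (hts.1 h)).1 rfl
    refine ⟨⟨htne, Finset.ssubset_iff_subset_ne.2 ⟨hts', fun h => hvt (h ▸ hv)⟩⟩, hvt,
      htne.mono Finset.subset_union_left, Finset.ssubset_iff_subset_ne.2
        ⟨Finset.union_subset hts' (Finset.singleton_subset_iff.2 hv), fun h => hts.ne ?_⟩⟩
    rw [← h, Finset.union_comm, ← Finset.insert_eq, Finset.erase_insert hvt]

/-- **`∂Δⁿ⁺¹` is a closed combinatorial `n`-manifold**: on any `n + 2` vertices, the link of each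
vertex `v` of `∂Δ(s)` is `∂Δ(s ∖ {v})`, a combinatorial `(n-1)`-sphere (the base case of "stellar
spheres are stellar manifolds", Lickorish 1999, proof of Lemma 3.2; Datta 2007, §1 (i)).  In
particular the boundary complex of a `5`-simplex is a closed combinatorial `4`-manifold
(non-vacuity of the notion for route `SmoothPoincare4/LogCYSkeleton`). [folklore] -/
theorem isClosedCombinatorialManifold_simplexBoundary {s : Finset ι} {n : ℕ} (hs : s.card = n + 2) :
    IsClosedCombinatorialManifold n (simplexBoundary s).faces := by
  intro v hv
  obtain ⟨t, ht, hvt⟩ := mem_vertexSet.1 hv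
  have hvs : v ∈ s := (mem_simplexBoundary_faces.1 ht).2.subset hvt
  rw [link_simplexBoundary_singleton hvs]
  exact StellarEquivalent.of_isomorphic
    (isomorphic_simplexBoundary_univ' (by rw [Finset.card_erase_of_mem hvs, hs]; rfl))

/-- The antistar of a vertex of `∂Δ(s)` is the full simplex `Δ(s ∖ {v})` on the remaining vertices
(so it is a combinatorial ball, `isCombinatorialBall_simplex`; and it collapses to a vertex).
[folklore] -/
theorem antistar_simplexBoundary {s : Finset ι} {v : ι} (hv : v ∈ s) :
    antistar (simplexBoundary s).faces v = simplex (s.erase v) := by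
  ext t
  simp only [mem_antistar, mem_simplexBoundary_faces, mem_simplex]
  constructor
  · rintro ⟨⟨htne, hts⟩, hvt⟩
    exact ⟨htne, fun x hx => Finset.mem_erase.2 ⟨fun h => hvt (h ▸ hx), hts.1 hx⟩⟩
  · rintro ⟨htne, hts⟩
    have hvt : v ∉ t := fun h => (Finset.mem_erase.1 (hts h)).1 rfl
    exact ⟨⟨htne, Finset.ssubset_iff_subset_ne.2 ⟨fun x hx => (Finset.mem_erase.1 (hts hx)).2,
      fun h => hvt (h ▸ hv)⟩⟩, hvt⟩

/-- The antistar of a vertex of `∂Δⁿ⁺¹` is a combinatorial `n`-ball. [folklore] -/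
theorem isCombinatorialBall_antistar_simplexBoundary {s : Finset ι} {n : ℕ} (hs : s.card = n + 2)
    {v : ι} (hv : v ∈ s) : IsCombinatorialBall n (antistar (simplexBoundary s).faces v) := by
  rw [antistar_simplexBoundary hv]
  exact isCombinatorialBall_simplex (by rw [Finset.card_erase_of_mem hv, hs]; rfl)

end Faces

end Literature.Topology.FourManifolds
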